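import Literature.AlgebraicGeometry.Resolution.BlowupStalkCharts
import Literature.AlgebraicGeometry.Resolution.OneDimensionalBlowupTower
import Literature.AlgebraicGeometry.Resolution.AffineBlowupAlgebra
import Literature.AlgebraicGeometry.Resolution.BlowupChartModule
import HarnessLib

/-!
# Local blow-up chains are bounded by a strictly decreasing invariant

Topic: `Literature/AlgebraicGeometry/Resolution`. The ASSEMBLY step of Krull's / Kollár's
blow-up tower theorem (Kollár 2007, Thm. 1.101 with Algorithm 1.100: the blow-up sequence
`S₀ = S, S₁ = B S₀, …` of a one-dimensional local ring stabilises at regular rings), separated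
from its commutative algebra. The named fact `Kollar2007_thm_1_101_localChain`
(`OneDimensionalBlowupTower.lean`) reads the tower POINTWISE: a chain of rings
`A ≅ R₀, R₁, R₂, …` in which `R_{i+1} ≅ 𝒪_{X',x'}` is the local ring at a point `x'` over `x`
of a blowing up `π : X' → X` (`IsBlowup π D`) of some scheme `X` with `𝒪_{X,x} ≅ R_i` along a
centre `D` with `D_x = 𝔪_x`. By the tree's chart dictionary
`IsBlowup.exists_reesChart_stalk` (`BlowupStalkCharts.lean`; Stacks 0804/0805: blowing up
commutes with the flat base change `Spec 𝒪_{X,x} → X`, and `Bl_𝔪 Spec 𝒪_{X,x}` is covered by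
the charts `Spec B_j`, `B_j = 𝒪_{X,x}[𝔪/c_j]` = `chartRing c j` of `BlowupChartRsop.lean`), such
an `𝒪_{X',x'}` is a localization `(B_j)_𝔴` at a prime `𝔴` over `𝔪_x`, for ANY chosen finite
generating family `c` of `𝔪_x`. Hence (this file, all PROVED, no definitions):

* `localBlowupChain_invariant_add_le` — if `P` (a class of rings) and `Φ : rings → ℕ` are
  invariant under ring isomorphisms and satisfy the ONE-STEP CHART HYPOTHESIS «`P R`, `R` local
  and not regular ⇒ for some finite generating family `c` of `𝔪_R`, every local ring
  `(chartRing c j)_𝔴` at a prime `𝔴` over `𝔪_R` satisfies `P` and has strictly smaller `Φ`»,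
  then along every chain as above starting at `A` with `P A` and containing no regular ring up
  to index `n`, `P (R i)` and `Φ (R i) + i ≤ Φ A` for all `i ≤ n`;
* `exists_isRegularLocalRing_of_localBlowupChain` — consequently some `R i`, `i ≤ Φ A + 1`,
  is a regular local ring (the chain clause of `Kollar2007_thm_1_101_localChain` with
  `m = Φ A + 1`); `exists_isRegularLocalRing_of_localBlowupChain_of_zero` — with `m = Φ A` when
  moreover `Φ R = 0 ⇒ R regular` on `P`;
* `kollar2007_thm_1_101_localChain_of_invariant` — **`Kollar2007_thm_1_101_localChain` follows
  from any such pair `(P, Φ)` with `P A` for every one-dimensional Noetherian local `A` with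
  reduced `𝔪`-adic completion** (the intended instance: `P` = "one-dimensional Noetherian local,
  reduced, with module-finite normalization", `Φ` = Kollár's `δ`/length invariant of 1.100–1.101;
  that algebra is NOT in this file).

* `exists_primeSpectrum_blowupAlgebra_ringEquiv_localization`,
  `localBlowupChain_hstep_of_blowupAlgebra(_local)`,
  `kollar2007_thm_1_101_localChain_of_invariant(_local)_blowupAlgebra` — the same with the
  one-step hypothesis checked on the affine blow-up algebras `R[𝔪/c_j] ⊆ R[1/c_j]`
  (`blowupAlgebra`, the image model; `reesChartEquiv` of `AffineBlowupAlgebra.lean`).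
* `exists_subalgebra_fractionRing_of_blowupAlgebra`,
  `localBlowupChain_hstep_blowupAlgebra_of_fractionRing(_local)`,
  `kollar2007_thm_1_101_localChain_of_invariant(_local)_fractionRing` — the same with the
  one-step hypothesis checked on the subalgebras `B ⊆ Frac R`, `𝔪/c_j ⊆ B ⊆ ⋃ₙ 𝔪ⁿ/c_jⁿ`, for
  non-zero-divisors `c_j` (the setting of `QuadraticTransformNormalization.lean`).

No definitions, no named facts; nothing here is specific to dimension one.

## Sources

* J. Kollár, *Lectures on Resolution of Singularities*, Ann. of Math. Stud. 166 (2007), §1.13,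
  Def. 1.97, Alg. 1.100, Thm. 1.101 (pp. 57–59). [Kollar2007]
* The Stacks Project, Tags 0804 (affine blow-up algebras and their charts), 0805 (blowing up
  commutes with flat base change). [StacksProject]
* U. Görtz, T. Wedhorn, *Algebraic Geometry I*, 2nd ed. (2020), Prop. 13.91. [GortzWedhorn2020]
-/

noncomputable section

open CategoryTheory AlgebraicGeometry IsLocalRing

namespace Literature.AlgebraicGeometry.Resolution

universe u

section Invariant

variable (P : ∀ (R : Type u) [CommRing R], Prop) (Φ : ∀ (R : Type u) [CommRing R], ℕ)
  (hP : ∀ (R S : Type u) [CommRing R] [CommRing S], (R ≃+* S) → P R → P S)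
  (hΦ : ∀ (R S : Type u) [CommRing R] [CommRing S], (R ≃+* S) → P R → Φ R = Φ S)
  (hstep : ∀ (R : Type u) [CommRing R] [IsLocalRing R], P R → ¬ IsRegularLocalRing R →
    ∃ (k : ℕ) (c : Fin k → R), Ideal.span (Set.range c) = maximalIdeal R ∧
      ∀ (j : Fin k) (𝔴 : PrimeSpectrum (chartRing c j)),
        𝔴.asIdeal.comap (chartBase c j) = maximalIdeal R →
          P (Localization.AtPrime 𝔴.asIdeal) ∧ Φ (Localization.AtPrime 𝔴.asIdeal) < Φ R)

include hP hΦ hstep in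
/-- **The invariant drops by at least one at every step of a local blow-up chain.** Let `P`,
`Φ` be invariant under ring isomorphisms and satisfy the one-step chart hypothesis `hstep`:
if `P R` holds for a local ring `R` which is not regular, then for some finite generating family
`c` of `𝔪_R`, at every prime `𝔴` over `𝔪_R` of every chart ring `B_j = R[𝔪/c_j]`
(`chartRing c j`) of `Bl_𝔪 Spec R`, the local ring `(B_j)_𝔴` satisfies `P` and
`Φ (B_j)_𝔴 < Φ R`. Let `A ≅ R₀, R₁, …` be a chain in which, for `i < n`, `R_{i+1} ≅ 𝒪_{X',x'}`
for a point `x'` over `x` of a blowing up `π : X' → X` along `D` with `D_x = 𝔪_x` and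
`𝒪_{X,x} ≅ R_i`, and suppose `P A` and that no `R_i`, `i ≤ n`, is a regular local ring. Then
`P (R i)` and `Φ (R i) + i ≤ Φ A` for every `i ≤ n` — because `𝒪_{X',x'}` is one of the
`(B_j)_𝔴` (`IsBlowup.exists_reesChart_stalk`).
[cite: Kollar2007, Alg. 1.100 and Thm. 1.101 (pp. 57–59)] [cite: StacksProject, Tag 0804] -/
theorem localBlowupChain_invariant_add_le {A : Type u} [CommRing A] (hA : P A) {n : ℕ}
    (R : ℕ → CommRingCat.{u}) (h0 : Nonempty (R 0 ≅ CommRingCat.of A))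
    (hchain : ∀ i, i < n → ∃ (X X' : Scheme.{u}) (π : X' ⟶ X) (D : X.IdealSheafData)
        (x : X) (x' : X'),
      IsBlowup π D ∧ stalkIdeal D x = maximalIdeal (X.presheaf.stalk x) ∧ π.base x' = x ∧
        Nonempty (X.presheaf.stalk x ≅ R i) ∧ Nonempty (X'.presheaf.stalk x' ≅ R (i + 1)))
    (hnreg : ∀ i, i ≤ n → ¬ IsRegularLocalRing (R i)) :
    ∀ i, i ≤ n → P (R i) ∧ Φ (R i) + i ≤ Φ A := by
  intro i
  induction i with
  | zero =>
    intro _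
    obtain ⟨e⟩ := h0
    have e' : A ≃+* R 0 := e.commRingCatIsoToRingEquiv.symm
    refine ⟨hP A _ e' hA, ?_⟩
    rw [← hΦ A _ e' hA, Nat.add_zero]
  | succ i ih =>
    intro hi
    have hi' : i < n := Nat.lt_of_succ_le hi
    obtain ⟨hPi, hΦi⟩ := ih hi'.le
    obtain ⟨X, X', π, D, x, x', hπ, hD, hx, ⟨e₁⟩, ⟨e₂⟩⟩ := hchain i hi'
    subst hx
    -- the local ring downstairs is `R i` up to isomorphism: it satisfies `P`, is not regular
    have eS : R i ≃+* X.presheaf.stalk (π.base x') := e₁.commRingCatIsoToRingEquiv.symm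
    have hPS : P (X.presheaf.stalk (π.base x')) := hP _ _ eS hPi
    have hregS : ¬ IsRegularLocalRing (X.presheaf.stalk (π.base x')) := fun hreg =>
      hnreg i hi'.le (@IsRegularLocalRing.of_ringEquiv _ _ hreg _ _ eS.symm)
    -- the one-step hypothesis, at the chart point computing `𝒪_{X',x'}`
    obtain ⟨k, c, hc, H⟩ := hstep _ hPS hregS
    obtain ⟨j, 𝔴, χ, -, hloc, h𝔴⟩ := hπ.exists_reesChart_stalk x' c (hc.trans hD.symm)
    obtain ⟨hP', hΦ'⟩ := H j 𝔴 h𝔴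
    letI := χ.toAlgebra
    haveI := hloc
    have e' : Localization.AtPrime 𝔴.asIdeal ≃+* R (i + 1) :=
      (IsLocalization.algEquiv 𝔴.asIdeal.primeCompl (Localization.AtPrime 𝔴.asIdeal)
          (X'.presheaf.stalk x')).toRingEquiv.trans e₂.commRingCatIsoToRingEquiv
    refine ⟨hP _ _ e' hP', ?_⟩
    rw [← hΦ _ _ e' hP']
    have hΦS : Φ (R i) = Φ (X.presheaf.stalk (π.base x')) := hΦ _ _ eS hPi
    omega

include hP hΦ hstep in
/-- **A local blow-up chain reaches a regular local ring within `Φ A + 1` steps.** Under the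
hypotheses of `localBlowupChain_invariant_add_le` (ring-isomorphism invariance of `P`, `Φ` and the
one-step chart hypothesis), for every `A` with `P A` and every chain `A ≅ R₀, R₁, …` of local
blow-up steps (`R_{i+1} ≅ 𝒪_{X',x'}`, `x'` over `x`, `π : X' → X` a blowing up along `D` with
`D_x = 𝔪_x`, `𝒪_{X,x} ≅ R_i`) defined for `i < Φ A + 1`, some `R_i` with `i ≤ Φ A + 1` is a
regular local ring. This is the chain clause of `Kollar2007_thm_1_101_localChain` with the bound
`m = Φ A + 1`. [cite: Kollar2007, Alg. 1.100 and Thm. 1.101 (3) ⇒ (1) (pp. 57–59)]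
[cite: StacksProject, Tag 0804] -/
theorem exists_isRegularLocalRing_of_localBlowupChain {A : Type u} [CommRing A] (hA : P A)
    (R : ℕ → CommRingCat.{u}) (h0 : Nonempty (R 0 ≅ CommRingCat.of A))
    (hchain : ∀ i, i < Φ A + 1 → ∃ (X X' : Scheme.{u}) (π : X' ⟶ X) (D : X.IdealSheafData)
        (x : X) (x' : X'),
      IsBlowup π D ∧ stalkIdeal D x = maximalIdeal (X.presheaf.stalk x) ∧ π.base x' = x ∧
        Nonempty (X.presheaf.stalk x ≅ R i) ∧ Nonempty (X'.presheaf.stalk x' ≅ R (i + 1))) :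
    ∃ i, i ≤ Φ A + 1 ∧ IsRegularLocalRing (R i) := by
  by_contra h
  push Not at h
  have hle := localBlowupChain_invariant_add_le P Φ hP hΦ hstep hA R h0 hchain h (Φ A + 1) le_rfl
  omega

include hP hΦ hstep in
/-- **Variant with the sharp bound `m = Φ A`.** If in addition `Φ R = 0` forces `R` to be a
regular local ring on the class `P` (as for Kollár's invariant: `δ = 0` iff `R` is normal, i.e. a
discrete valuation ring, in dimension one), then in every chain of local blow-up steps starting at
`A` with `P A` and defined for `i < Φ A`, some `R_i` with `i ≤ Φ A` is regular.
[cite: Kollar2007, Alg. 1.100 and Thm. 1.101 (3) ⇒ (1) (pp. 57–59)]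
[cite: StacksProject, Tag 0804] -/
theorem exists_isRegularLocalRing_of_localBlowupChain_of_zero
    (hzero : ∀ (R : Type u) [CommRing R], P R → Φ R = 0 → IsRegularLocalRing R)
    {A : Type u} [CommRing A] (hA : P A)
    (R : ℕ → CommRingCat.{u}) (h0 : Nonempty (R 0 ≅ CommRingCat.of A))
    (hchain : ∀ i, i < Φ A → ∃ (X X' : Scheme.{u}) (π : X' ⟶ X) (D : X.IdealSheafData)
        (x : X) (x' : X'),
      IsBlowup π D ∧ stalkIdeal D x = maximalIdeal (X.presheaf.stalk x) ∧ π.base x' = x ∧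
        Nonempty (X.presheaf.stalk x ≅ R i) ∧ Nonempty (X'.presheaf.stalk x' ≅ R (i + 1))) :
    ∃ i, i ≤ Φ A ∧ IsRegularLocalRing (R i) := by
  by_contra h
  push Not at h
  obtain ⟨hPm, hΦm⟩ :=
    localBlowupChain_invariant_add_le P Φ hP hΦ hstep hA R h0 hchain h (Φ A) le_rfl
  exact h (Φ A) le_rfl (hzero _ hPm (by omega))

include hP hΦ hstep in
/-- **`Kollar2007_thm_1_101_localChain` from a strictly decreasing invariant.** If `P`, `Φ` are
invariant under ring isomorphisms, satisfy the one-step chart hypothesis (`P R`, `R` local not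
regular ⇒ for some generators `c` of `𝔪_R`, every `(chartRing c j)_𝔴` with `𝔴` over `𝔪_R`
satisfies `P` and has smaller `Φ`), and `P A` holds for every one-dimensional Noetherian local ring
`A` whose `𝔪`-adic completion is reduced, then the named fact
`Kollar2007_thm_1_101_localChain` (Kollár 2007, Thm. 1.101 (3) ⇒ (1), read pointwise along local
blow-up chains) holds, with the bound `m(A) = Φ A + 1`. The commutative algebra — the choice of
`P` (reduced with module-finite normalization) and of `Φ` (Kollár's length invariant) and the
one-step drop — is the content of Thm. 1.101 and is NOT proved here.
[cite: Kollar2007, Thm. 1.101, Def. 1.97, Alg. 1.100 (pp. 57–59)]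
[cite: GortzWedhorn2020, Prop. 13.91 (2)] -/
theorem kollar2007_thm_1_101_localChain_of_invariant
    (hA : ∀ (A : Type u) [CommRing A] [IsLocalRing A] [IsNoetherianRing A],
      ringKrullDim A = 1 → IsReduced (AdicCompletion (maximalIdeal A) A) → P A) :
    Kollar2007_thm_1_101_localChain.{u} := by
  intro A _ _ _ hdim hred
  exact ⟨Φ A + 1, fun R h0 hchain =>
    exists_isRegularLocalRing_of_localBlowupChain P Φ hP hΦ hstep (hA A hdim hred) R h0 hchain⟩

end Invariant

/-! ## Variant: the class and the invariant are defined on local rings only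

The same statements for `P`, `Φ` taking an `[IsLocalRing R]` instance argument (so that they may
be defined through `IsLocalRing.maximalIdeal R`, `IsLocalRing.ResidueField R`, …); reduced to the
previous section with `P₀ R = ∃ _ : IsLocalRing R, P R` and `Φ₀ R = if IsLocalRing R then Φ R else 0`.
-/

section LocalInvariant

variable (P : ∀ (R : Type u) [CommRing R] [IsLocalRing R], Prop)
  (Φ : ∀ (R : Type u) [CommRing R] [IsLocalRing R], ℕ)
  (hP : ∀ (R S : Type u) [CommRing R] [IsLocalRing R] [CommRing S] [IsLocalRing S],
    (R ≃+* S) → P R → P S)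
  (hΦ : ∀ (R S : Type u) [CommRing R] [IsLocalRing R] [CommRing S] [IsLocalRing S],
    (R ≃+* S) → P R → Φ R = Φ S)
  (hstep : ∀ (R : Type u) [CommRing R] [IsLocalRing R], P R → ¬ IsRegularLocalRing R →
    ∃ (k : ℕ) (c : Fin k → R), Ideal.span (Set.range c) = maximalIdeal R ∧
      ∀ (j : Fin k) (𝔴 : PrimeSpectrum (chartRing c j)),
        𝔴.asIdeal.comap (chartBase c j) = maximalIdeal R →
          P (Localization.AtPrime 𝔴.asIdeal) ∧ Φ (Localization.AtPrime 𝔴.asIdeal) < Φ R)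

include hP hΦ hstep in
/-- **A local blow-up chain reaches a regular local ring within `Φ A + 1` steps** — form for a
class `P` and an invariant `Φ` defined on LOCAL rings (instance arguments `[IsLocalRing R]`),
invariant under ring isomorphisms of local rings and satisfying the one-step chart hypothesis:
for every local `A` with `P A` and every chain `A ≅ R₀, R₁, …` of local blow-up steps
(`R_{i+1} ≅ 𝒪_{X',x'}`, `x'` over `x`, `π : X' → X` a blowing up along `D` with `D_x = 𝔪_x`,
`𝒪_{X,x} ≅ R_i`) defined for `i < Φ A + 1`, some `R_i`, `i ≤ Φ A + 1`, is a regular local ring.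
[cite: Kollar2007, Alg. 1.100 and Thm. 1.101 (3) ⇒ (1) (pp. 57–59)]
[cite: StacksProject, Tag 0804] -/
theorem exists_isRegularLocalRing_of_localBlowupChain_local {A : Type u} [CommRing A]
    [IsLocalRing A] (hA : P A)
    (R : ℕ → CommRingCat.{u}) (h0 : Nonempty (R 0 ≅ CommRingCat.of A))
    (hchain : ∀ i, i < Φ A + 1 → ∃ (X X' : Scheme.{u}) (π : X' ⟶ X) (D : X.IdealSheafData)
        (x : X) (x' : X'),
      IsBlowup π D ∧ stalkIdeal D x = maximalIdeal (X.presheaf.stalk x) ∧ π.base x' = x ∧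
        Nonempty (X.presheaf.stalk x ≅ R i) ∧ Nonempty (X'.presheaf.stalk x' ≅ R (i + 1))) :
    ∃ i, i ≤ Φ A + 1 ∧ IsRegularLocalRing (R i) := by
  classical
  -- forget the instance arguments
  let P₀ : ∀ (R : Type u) [CommRing R], Prop := fun R _ => ∃ _ : IsLocalRing R, P R
  let Φ₀ : ∀ (R : Type u) [CommRing R], ℕ := fun R _ => if h : IsLocalRing R then Φ R else 0
  have hΦ₀_eq : ∀ (R : Type u) [CommRing R] [h : IsLocalRing R], Φ₀ R = Φ R :=
    fun R _ h => dif_pos h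
  have hP₀ : ∀ (R S : Type u) [CommRing R] [CommRing S], (R ≃+* S) → P₀ R → P₀ S := by
    intro R S _ _ e hR
    obtain ⟨hR, hPR⟩ := hR
    haveI := e.isLocalRing
    exact ⟨inferInstance, hP R S e hPR⟩
  have hΦ₀ : ∀ (R S : Type u) [CommRing R] [CommRing S], (R ≃+* S) → P₀ R → Φ₀ R = Φ₀ S := by
    intro R S _ _ e hR
    obtain ⟨hR, hPR⟩ := hR
    haveI := e.isLocalRing
    rw [hΦ₀_eq R, hΦ₀_eq S]
    exact hΦ R S e hPR
  have hstep₀ : ∀ (R : Type u) [CommRing R] [IsLocalRing R], P₀ R → ¬ IsRegularLocalRing R →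
      ∃ (k : ℕ) (c : Fin k → R), Ideal.span (Set.range c) = maximalIdeal R ∧
        ∀ (j : Fin k) (𝔴 : PrimeSpectrum (chartRing c j)),
          𝔴.asIdeal.comap (chartBase c j) = maximalIdeal R →
            P₀ (Localization.AtPrime 𝔴.asIdeal) ∧
              Φ₀ (Localization.AtPrime 𝔴.asIdeal) < Φ₀ R := by
    intro R _ _ hR hreg
    obtain ⟨_, hPR⟩ := hR
    obtain ⟨k, c, hc, H⟩ := hstep R hPR hreg
    refine ⟨k, c, hc, fun j 𝔴 h𝔴 => ⟨⟨inferInstance, (H j 𝔴 h𝔴).1⟩, ?_⟩⟩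
    rw [hΦ₀_eq, hΦ₀_eq R]
    exact (H j 𝔴 h𝔴).2
  have hA₀ : P₀ A := ⟨inferInstance, hA⟩
  have hchain₀ : ∀ i, i < Φ₀ A + 1 → ∃ (X X' : Scheme.{u}) (π : X' ⟶ X) (D : X.IdealSheafData)
        (x : X) (x' : X'),
      IsBlowup π D ∧ stalkIdeal D x = maximalIdeal (X.presheaf.stalk x) ∧ π.base x' = x ∧
        Nonempty (X.presheaf.stalk x ≅ R i) ∧ Nonempty (X'.presheaf.stalk x' ≅ R (i + 1)) := by
    rw [hΦ₀_eq A]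
    exact hchain
  have h := exists_isRegularLocalRing_of_localBlowupChain P₀ Φ₀ hP₀ hΦ₀ hstep₀ hA₀ R h0 hchain₀
  rwa [hΦ₀_eq A] at h

include hP hΦ hstep in
/-- **`Kollar2007_thm_1_101_localChain` from a strictly decreasing invariant of local rings** —
form for `P`, `Φ` defined on local rings (instance arguments `[IsLocalRing R]`): if they are
invariant under isomorphisms of local rings, satisfy the one-step chart hypothesis, and `P A`
holds for every one-dimensional Noetherian local ring `A` with reduced `𝔪`-adic completion,
then `Kollar2007_thm_1_101_localChain` holds (bound `m(A) = Φ A + 1`).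
[cite: Kollar2007, Thm. 1.101, Def. 1.97, Alg. 1.100 (pp. 57–59)]
[cite: GortzWedhorn2020, Prop. 13.91 (2)] -/
theorem kollar2007_thm_1_101_localChain_of_invariant_local
    (hA : ∀ (A : Type u) [CommRing A] [IsLocalRing A] [IsNoetherianRing A],
      ringKrullDim A = 1 → IsReduced (AdicCompletion (maximalIdeal A) A) → P A) :
    Kollar2007_thm_1_101_localChain.{u} := by
  intro A _ _ _ hdim hred
  exact ⟨Φ A + 1, fun R h0 hchain =>
    exists_isRegularLocalRing_of_localBlowupChain_local P Φ hP hΦ hstep (hA A hdim hred) R h0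
      hchain⟩

end LocalInvariant

/-! ## Adapter: the one-step hypothesis in the image model `R[𝔪/c_j] ⊆ R[1/c_j]`

The chart ring `chartRing c j = (R[It])_{(c_j t)}` (a homogeneous localization of the Rees
algebra) is isomorphic, compatibly with the structure maps, to the affine blow-up algebra
`blowupAlgebra I (c j) = R[I/c_j] ⊆ R[1/c_j]` (`reesChartEquiv`, `AffineBlowupAlgebra.lean`;
Stacks 0804/07Z3). Primes over `𝔪_R` and local rings correspond, so the one-step hypothesis may
be verified in whichever model is convenient for the commutative algebra.
-/

section ImageModel

/-- **Chart ring versus affine blow-up algebra, at a prime.** For a prime `𝔴` of the chart ring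
`(R[It])_{(c_j t)}`, `I = (c)`, its image `𝔮` in `R[I/c_j] ⊆ R[1/c_j]` under `reesChartEquiv`
lies over the same ideal of `R`, and the local rings `((R[It])_{(c_j t)})_𝔴 ≅ (R[I/c_j])_𝔮` are
isomorphic. [cite: StacksProject, Tag 0804] -/
theorem exists_primeSpectrum_blowupAlgebra_ringEquiv_localization {R : Type u} [CommRing R]
    {k : ℕ} (c : Fin k → R) (j : Fin k) (𝔴 : PrimeSpectrum (chartRing c j)) :
    ∃ 𝔮 : PrimeSpectrum (blowupAlgebra (Ideal.span (Set.range c)) (c j)),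
      𝔮.asIdeal.comap (algebraMap R _) = 𝔴.asIdeal.comap (chartBase c j) ∧
        Nonempty (Localization.AtPrime 𝔴.asIdeal ≃+* Localization.AtPrime 𝔮.asIdeal) := by
  set e : chartRing c j ≃+* blowupAlgebra (Ideal.span (Set.range c)) (c j) :=
    reesChartEquiv (I := Ideal.span (Set.range c)) (c j)
      (Ideal.mem_span_range_self (f := c) (x := j)) with he
  let 𝔮 : PrimeSpectrum (blowupAlgebra (Ideal.span (Set.range c)) (c j)) :=
    PrimeSpectrum.comap e.symm.toRingHom 𝔴
  have h𝔮 : ∀ x, x ∈ 𝔮.asIdeal ↔ e.symm x ∈ 𝔴.asIdeal := fun x => Iff.rfl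
  refine ⟨𝔮, ?_, ⟨IsLocalization.ringEquivOfRingEquiv (M := 𝔴.asIdeal.primeCompl)
    (T := 𝔮.asIdeal.primeCompl) (Localization.AtPrime 𝔴.asIdeal)
    (Localization.AtPrime 𝔮.asIdeal) e ?_⟩⟩
  · ext r
    rw [Ideal.mem_comap, Ideal.mem_comap, h𝔮, ← reesChartEquiv_reesChartBase, ← he,
      RingEquiv.symm_apply_apply]
  · ext x
    simp only [Submonoid.mem_map, Ideal.mem_primeCompl_iff]
    constructor
    · rintro ⟨y, hy, rfl⟩
      rw [h𝔮]
      change e.symm (e y) ∉ 𝔴.asIdeal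
      rwa [RingEquiv.symm_apply_apply]
    · intro hx
      exact ⟨e.symm x, (h𝔮 x).not.mp hx, e.apply_symm_apply x⟩

variable (P : ∀ (R : Type u) [CommRing R], Prop) (Φ : ∀ (R : Type u) [CommRing R], ℕ)
  (hP : ∀ (R S : Type u) [CommRing R] [CommRing S], (R ≃+* S) → P R → P S)
  (hΦ : ∀ (R S : Type u) [CommRing R] [CommRing S], (R ≃+* S) → P R → Φ R = Φ S)
  (hstep' : ∀ (R : Type u) [CommRing R] [IsLocalRing R], P R → ¬ IsRegularLocalRing R →
    ∃ (k : ℕ) (c : Fin k → R), Ideal.span (Set.range c) = maximalIdeal R ∧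
      ∀ (j : Fin k) (𝔮 : PrimeSpectrum (blowupAlgebra (Ideal.span (Set.range c)) (c j))),
        𝔮.asIdeal.comap (algebraMap R _) = maximalIdeal R →
          P (Localization.AtPrime 𝔮.asIdeal) ∧ Φ (Localization.AtPrime 𝔮.asIdeal) < Φ R)

include hP hΦ hstep' in
/-- **The one-step hypothesis may be checked on the affine blow-up algebras `R[𝔪/c_j] ⊆ R[1/c_j]`**
(`blowupAlgebra`, the image model) instead of the chart rings `(R[𝔪t])_{(c_j t)}`: the two are
isomorphic over `R` (`reesChartEquiv`), primes over `𝔪_R` correspond and the local rings agree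
(`exists_primeSpectrum_blowupAlgebra_ringEquiv_localization`), and `P`, `Φ` are invariant under
ring isomorphisms. [cite: StacksProject, Tag 0804] -/
theorem localBlowupChain_hstep_of_blowupAlgebra :
    ∀ (R : Type u) [CommRing R] [IsLocalRing R], P R → ¬ IsRegularLocalRing R →
      ∃ (k : ℕ) (c : Fin k → R), Ideal.span (Set.range c) = maximalIdeal R ∧
        ∀ (j : Fin k) (𝔴 : PrimeSpectrum (chartRing c j)),
          𝔴.asIdeal.comap (chartBase c j) = maximalIdeal R →
            P (Localization.AtPrime 𝔴.asIdeal) ∧ Φ (Localization.AtPrime 𝔴.asIdeal) < Φ R := by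
  intro R _ _ hR hreg
  obtain ⟨k, c, hc, H⟩ := hstep' R hR hreg
  refine ⟨k, c, hc, fun j 𝔴 h𝔴 => ?_⟩
  obtain ⟨𝔮, h𝔮, ⟨ε⟩⟩ := exists_primeSpectrum_blowupAlgebra_ringEquiv_localization c j 𝔴
  obtain ⟨hP𝔮, hΦ𝔮⟩ := H j 𝔮 (h𝔮.trans h𝔴)
  refine ⟨hP _ _ ε.symm hP𝔮, ?_⟩
  rw [← hΦ _ _ ε.symm hP𝔮]
  exact hΦ𝔮

include hP hΦ hstep' in
/-- **`Kollar2007_thm_1_101_localChain` from a strictly decreasing invariant, image-model form**: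
as `kollar2007_thm_1_101_localChain_of_invariant`, with the one-step hypothesis stated at the
primes over `𝔪_R` of the affine blow-up algebras `R[𝔪/c_j] ⊆ R[1/c_j]` (`blowupAlgebra`).
[cite: Kollar2007, Thm. 1.101, Def. 1.97, Alg. 1.100 (pp. 57–59)]
[cite: StacksProject, Tag 0804] -/
theorem kollar2007_thm_1_101_localChain_of_invariant_blowupAlgebra
    (hA : ∀ (A : Type u) [CommRing A] [IsLocalRing A] [IsNoetherianRing A],
      ringKrullDim A = 1 → IsReduced (AdicCompletion (maximalIdeal A) A) → P A) :
    Kollar2007_thm_1_101_localChain.{u} :=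
  kollar2007_thm_1_101_localChain_of_invariant P Φ hP hΦ
    (localBlowupChain_hstep_of_blowupAlgebra P Φ hP hΦ hstep') hA

end ImageModel

section ImageModelLocal

variable (P : ∀ (R : Type u) [CommRing R] [IsLocalRing R], Prop)
  (Φ : ∀ (R : Type u) [CommRing R] [IsLocalRing R], ℕ)
  (hP : ∀ (R S : Type u) [CommRing R] [IsLocalRing R] [CommRing S] [IsLocalRing S],
    (R ≃+* S) → P R → P S)
  (hΦ : ∀ (R S : Type u) [CommRing R] [IsLocalRing R] [CommRing S] [IsLocalRing S],
    (R ≃+* S) → P R → Φ R = Φ S)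
  (hstep' : ∀ (R : Type u) [CommRing R] [IsLocalRing R], P R → ¬ IsRegularLocalRing R →
    ∃ (k : ℕ) (c : Fin k → R), Ideal.span (Set.range c) = maximalIdeal R ∧
      ∀ (j : Fin k) (𝔮 : PrimeSpectrum (blowupAlgebra (Ideal.span (Set.range c)) (c j))),
        𝔮.asIdeal.comap (algebraMap R _) = maximalIdeal R →
          P (Localization.AtPrime 𝔮.asIdeal) ∧ Φ (Localization.AtPrime 𝔮.asIdeal) < Φ R)

include hP hΦ hstep' in
/-- Image-model form of the one-step hypothesis, for `P`, `Φ` defined on local rings (instance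
arguments `[IsLocalRing R]`). [cite: StacksProject, Tag 0804] -/
theorem localBlowupChain_hstep_of_blowupAlgebra_local :
    ∀ (R : Type u) [CommRing R] [IsLocalRing R], P R → ¬ IsRegularLocalRing R →
      ∃ (k : ℕ) (c : Fin k → R), Ideal.span (Set.range c) = maximalIdeal R ∧
        ∀ (j : Fin k) (𝔴 : PrimeSpectrum (chartRing c j)),
          𝔴.asIdeal.comap (chartBase c j) = maximalIdeal R →
            P (Localization.AtPrime 𝔴.asIdeal) ∧ Φ (Localization.AtPrime 𝔴.asIdeal) < Φ R := by
  intro R _ _ hR hreg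
  obtain ⟨k, c, hc, H⟩ := hstep' R hR hreg
  refine ⟨k, c, hc, fun j 𝔴 h𝔴 => ?_⟩
  obtain ⟨𝔮, h𝔮, ⟨ε⟩⟩ := exists_primeSpectrum_blowupAlgebra_ringEquiv_localization c j 𝔴
  obtain ⟨hP𝔮, hΦ𝔮⟩ := H j 𝔮 (h𝔮.trans h𝔴)
  refine ⟨hP _ _ ε.symm hP𝔮, ?_⟩
  rw [← hΦ _ _ ε.symm hP𝔮]
  exact hΦ𝔮

include hP hΦ hstep' in
/-- **`Kollar2007_thm_1_101_localChain` from a strictly decreasing invariant of local rings,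
image-model form** (one-step hypothesis on the affine blow-up algebras `R[𝔪/c_j]`).
[cite: Kollar2007, Thm. 1.101, Def. 1.97, Alg. 1.100 (pp. 57–59)]
[cite: StacksProject, Tag 0804] -/
theorem kollar2007_thm_1_101_localChain_of_invariant_local_blowupAlgebra
    (hA : ∀ (A : Type u) [CommRing A] [IsLocalRing A] [IsNoetherianRing A],
      ringKrullDim A = 1 → IsReduced (AdicCompletion (maximalIdeal A) A) → P A) :
    Kollar2007_thm_1_101_localChain.{u} :=
  kollar2007_thm_1_101_localChain_of_invariant_local P Φ hP hΦ
    (localBlowupChain_hstep_of_blowupAlgebra_local P Φ hP hΦ hstep') hA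

end ImageModelLocal

/-! ## Adapter: the one-step hypothesis inside the total ring of fractions

For a non-zero-divisor `c_j`, the chart `R[𝔪/c_j] ⊆ R[1/c_j]` embeds into the total ring of
fractions `K = Frac R` (`R[1/c_j] → K` is injective), where it becomes a subalgebra `B ⊆ K` with
`𝔪/c_j ⊆ B ⊆ ⋃ₙ 𝔪ⁿ/c_jⁿ` — the presentation in which the `δ`-invariant / normalization argument
of Kollár's Thm. 1.101 is naturally carried out (`QuadraticTransformNormalization.lean`). So the
one-step hypothesis may also be verified for ALL such subalgebras `B` of `K` and their primes over
`𝔪`, provided the chosen generators of `𝔪` are non-zero-divisors (for a reduced one-dimensional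
local ring they can always be so chosen, by prime avoidance for cosets).
-/

section FractionRingModel

/-- **The affine blow-up algebra inside the total ring of fractions.** Let `a ∈ I` be a
non-zero-divisor of `R` and `K` a total ring of fractions of `R`. For every prime `𝔮` of
`R[I/a] ⊆ R[1/a]` there are a subalgebra `B ⊆ K` (the image of `R[I/a]` under the injection
`R[1/a] → K`) with `I/a ⊆ B` and `B ⊆ ⋃ₙ Iⁿ/aⁿ`, and a prime `𝔴` of `B` over the same ideal of `R`
as `𝔮`, with isomorphic local rings `(R[I/a])_𝔮 ≅ B_𝔴`. [cite: StacksProject, Tag 0804] -/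
theorem exists_subalgebra_fractionRing_of_blowupAlgebra {R : Type u} [CommRing R]
    (K : Type u) [CommRing K] [Algebra R K] [IsFractionRing R K]
    (I : Ideal R) {a : R} (haI : a ∈ I) (ha : a ∈ nonZeroDivisors R)
    (𝔮 : PrimeSpectrum (blowupAlgebra I a)) :
    ∃ (B : Subalgebra R K) (𝔴 : PrimeSpectrum B),
      (∀ x ∈ I, ∃ b ∈ B, algebraMap R K x = algebraMap R K a * b) ∧
      (∀ b ∈ B, ∃ (n : ℕ), ∃ m ∈ I ^ n, algebraMap R K (a ^ n) * b = algebraMap R K m) ∧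
      𝔴.asIdeal.comap (algebraMap R B) = 𝔮.asIdeal.comap (algebraMap R (blowupAlgebra I a)) ∧
      Nonempty (Localization.AtPrime 𝔮.asIdeal ≃+* Localization.AtPrime 𝔴.asIdeal) := by
  classical
  -- `φ : R[1/a] → K`, injective since `a` is a non-zero-divisor
  have haK : IsUnit (algebraMap R K a) := IsLocalization.map_units K ⟨a, ha⟩
  let φ₀ : Localization.Away a →+* K := IsLocalization.Away.lift a haK
  have hφ₀ : ∀ r : R, φ₀ (algebraMap R (Localization.Away a) r) = algebraMap R K r :=
    fun r => IsLocalization.Away.lift_eq a haK r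
  let φ : Localization.Away a →ₐ[R] K :=
    { φ₀ with commutes' := fun r => hφ₀ r }
  have hφ : ∀ z, φ z = φ₀ z := fun z => rfl
  have hφinj : Function.Injective φ := by
    rw [injective_iff_map_eq_zero]
    intro z hz
    obtain ⟨⟨r, ⟨_, n, rfl⟩⟩, hzr⟩ := IsLocalization.surj (Submonoid.powers a) z
    have h1 : algebraMap R K r = 0 := by
      have := congrArg φ hzr
      rw [map_mul, hz, zero_mul, AlgHom.commutes] at this
      exact this.symm
    have hr : r = 0 := (IsFractionRing.injective R K) (by rw [h1, map_zero])
    have h2 : z * algebraMap R (Localization.Away a) (a ^ n) = 0 := by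
      simpa [hr] using hzr
    exact (IsUnit.mul_left_eq_zero (IsLocalization.map_units (M := Submonoid.powers a)
      (Localization.Away a) ⟨a ^ n, n, rfl⟩)).mp h2
  -- the image subalgebra and the transported prime
  let B : Subalgebra R K := (blowupAlgebra I a).map φ
  let e : blowupAlgebra I a ≃ₐ[R] B := (blowupAlgebra I a).equivMapOfInjective φ hφinj
  let 𝔴 : PrimeSpectrum B := PrimeSpectrum.comap e.symm.toRingEquiv.toRingHom 𝔮
  have h𝔴 : ∀ x, x ∈ 𝔴.asIdeal ↔ e.symm x ∈ 𝔮.asIdeal := fun x => Iff.rfl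
  refine ⟨B, 𝔴, ?_, ?_, ?_, ⟨IsLocalization.ringEquivOfRingEquiv (M := 𝔮.asIdeal.primeCompl)
    (T := 𝔴.asIdeal.primeCompl) (Localization.AtPrime 𝔮.asIdeal)
    (Localization.AtPrime 𝔴.asIdeal) e.toRingEquiv ?_⟩⟩
  · -- `I/a ⊆ B`
    intro x hx
    refine ⟨φ (algebraMap R (Localization.Away a) x * IsLocalization.Away.invSelf a),
      Subalgebra.mem_map.mpr ⟨_, div_mem_blowupAlgebra I a hx, rfl⟩, ?_⟩
    rw [← AlgHom.commutes φ a, ← map_mul, ← AlgHom.commutes φ x]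
    congr 1
    rw [mul_comm, mul_assoc, mul_comm (IsLocalization.Away.invSelf a), IsLocalization.Away.mul_invSelf,
      mul_one]
  · -- `B ⊆ ⋃ₙ Iⁿ/aⁿ`
    intro b hb
    obtain ⟨z, hz, rfl⟩ := Subalgebra.mem_map.mp hb
    obtain ⟨n, y, hy, rfl⟩ := blowupAlgebra.exists_eq_mul_invSelf_pow I a haI hz
    refine ⟨n, y, hy, ?_⟩
    rw [← AlgHom.commutes φ (a ^ n), ← map_mul, ← AlgHom.commutes φ y]
    congr 1
    rw [mul_comm, mul_assoc, mul_comm (IsLocalization.Away.invSelf a ^ n),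
      algebraMap_pow_mul_invSelf_pow, mul_one]
  · -- same ideal of `R` below
    ext r
    rw [Ideal.mem_comap, Ideal.mem_comap, h𝔴, AlgEquiv.commutes]
  · -- the submonoids correspond
    ext x
    simp only [Submonoid.mem_map, Ideal.mem_primeCompl_iff]
    constructor
    · rintro ⟨y, hy, rfl⟩
      rw [h𝔴]
      change e.symm (e y) ∉ 𝔮.asIdeal
      rwa [AlgEquiv.symm_apply_apply]
    · intro hx
      exact ⟨e.symm x, (h𝔴 x).not.mp hx, e.apply_symm_apply x⟩

variable (P : ∀ (R : Type u) [CommRing R], Prop) (Φ : ∀ (R : Type u) [CommRing R], ℕ)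
  (hP : ∀ (R S : Type u) [CommRing R] [CommRing S], (R ≃+* S) → P R → P S)
  (hΦ : ∀ (R S : Type u) [CommRing R] [CommRing S], (R ≃+* S) → P R → Φ R = Φ S)
  (hstepK : ∀ (R : Type u) [CommRing R] [IsLocalRing R], P R → ¬ IsRegularLocalRing R →
    ∃ (k : ℕ) (c : Fin k → R), Ideal.span (Set.range c) = maximalIdeal R ∧
      (∀ j, c j ∈ nonZeroDivisors R) ∧
      ∀ (j : Fin k) (B : Subalgebra R (FractionRing R)),
        (∀ m ∈ maximalIdeal R, ∃ b ∈ B,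
          algebraMap R (FractionRing R) m = algebraMap R (FractionRing R) (c j) * b) →
        (∀ b ∈ B, ∃ (n : ℕ), ∃ m ∈ maximalIdeal R ^ n,
          algebraMap R (FractionRing R) (c j ^ n) * b = algebraMap R (FractionRing R) m) →
        ∀ (𝔴 : Ideal B) [𝔴.IsPrime], 𝔴.comap (algebraMap R B) = maximalIdeal R →
          P (Localization.AtPrime 𝔴) ∧ Φ (Localization.AtPrime 𝔴) < Φ R)

include hP hΦ hstepK in
/-- **The one-step hypothesis may be checked inside the total ring of fractions**: it suffices
that, for some family of NON-ZERO-DIVISORS `c` generating `𝔪_R`, every subalgebra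
`B ⊆ Frac R` with `𝔪/c_j ⊆ B ⊆ ⋃ₙ 𝔪ⁿ/c_jⁿ` and every prime `𝔴` of `B` over `𝔪_R` have
`P (B_𝔴)` and `Φ (B_𝔴) < Φ R` (`exists_subalgebra_fractionRing_of_blowupAlgebra` moves the
chart `R[𝔪/c_j]` into `Frac R`). [cite: StacksProject, Tag 0804]
[cite: Kollar2007, Thm. 1.101 (pp. 57–59)] -/
theorem localBlowupChain_hstep_blowupAlgebra_of_fractionRing :
    ∀ (R : Type u) [CommRing R] [IsLocalRing R], P R → ¬ IsRegularLocalRing R →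
      ∃ (k : ℕ) (c : Fin k → R), Ideal.span (Set.range c) = maximalIdeal R ∧
        ∀ (j : Fin k) (𝔮 : PrimeSpectrum (blowupAlgebra (Ideal.span (Set.range c)) (c j))),
          𝔮.asIdeal.comap (algebraMap R _) = maximalIdeal R →
            P (Localization.AtPrime 𝔮.asIdeal) ∧ Φ (Localization.AtPrime 𝔮.asIdeal) < Φ R := by
  intro R _ _ hR hreg
  obtain ⟨k, c, hc, hc0, H⟩ := hstepK R hR hreg
  refine ⟨k, c, hc, fun j 𝔮 h𝔮 => ?_⟩
  obtain ⟨B, 𝔴, hB1, hB2, h𝔴, ⟨ε⟩⟩ := exists_subalgebra_fractionRing_of_blowupAlgebra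
    (FractionRing R) (Ideal.span (Set.range c)) (Ideal.mem_span_range_self (f := c) (x := j))
    (hc0 j) 𝔮
  rw [hc] at hB1 hB2
  obtain ⟨hP𝔴, hΦ𝔴⟩ := H j B hB1 hB2 𝔴.asIdeal (h𝔴.trans h𝔮)
  refine ⟨hP _ _ ε.symm hP𝔴, ?_⟩
  rw [← hΦ _ _ ε.symm hP𝔴]
  exact hΦ𝔴

include hP hΦ hstepK in
/-- **`Kollar2007_thm_1_101_localChain` from a strictly decreasing invariant, total-ring-of-fractions
form**: `P`, `Φ` invariant under ring isomorphisms; the one-step drop verified for the local rings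
`B_𝔴` of the subalgebras `B ⊆ Frac R`, `𝔪/c_j ⊆ B ⊆ ⋃ₙ 𝔪ⁿ/c_jⁿ`, at primes over `𝔪`, for some
non-zero-divisors `c` generating `𝔪` (when `P R` and `R` is not regular); and `P A` for every
one-dimensional Noetherian local `A` with reduced completion.
[cite: Kollar2007, Thm. 1.101, Def. 1.97, Alg. 1.100 (pp. 57–59)]
[cite: StacksProject, Tag 0804] -/
theorem kollar2007_thm_1_101_localChain_of_invariant_fractionRing
    (hA : ∀ (A : Type u) [CommRing A] [IsLocalRing A] [IsNoetherianRing A],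
      ringKrullDim A = 1 → IsReduced (AdicCompletion (maximalIdeal A) A) → P A) :
    Kollar2007_thm_1_101_localChain.{u} :=
  kollar2007_thm_1_101_localChain_of_invariant_blowupAlgebra P Φ hP hΦ
    (localBlowupChain_hstep_blowupAlgebra_of_fractionRing P Φ hP hΦ hstepK) hA

end FractionRingModel

section FractionRingModelLocal

variable (P : ∀ (R : Type u) [CommRing R] [IsLocalRing R], Prop)
  (Φ : ∀ (R : Type u) [CommRing R] [IsLocalRing R], ℕ)
  (hP : ∀ (R S : Type u) [CommRing R] [IsLocalRing R] [CommRing S] [IsLocalRing S],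
    (R ≃+* S) → P R → P S)
  (hΦ : ∀ (R S : Type u) [CommRing R] [IsLocalRing R] [CommRing S] [IsLocalRing S],
    (R ≃+* S) → P R → Φ R = Φ S)
  (hstepK : ∀ (R : Type u) [CommRing R] [IsLocalRing R], P R → ¬ IsRegularLocalRing R →
    ∃ (k : ℕ) (c : Fin k → R), Ideal.span (Set.range c) = maximalIdeal R ∧
      (∀ j, c j ∈ nonZeroDivisors R) ∧
      ∀ (j : Fin k) (B : Subalgebra R (FractionRing R)),
        (∀ m ∈ maximalIdeal R, ∃ b ∈ B,
          algebraMap R (FractionRing R) m = algebraMap R (FractionRing R) (c j) * b) →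
        (∀ b ∈ B, ∃ (n : ℕ), ∃ m ∈ maximalIdeal R ^ n,
          algebraMap R (FractionRing R) (c j ^ n) * b = algebraMap R (FractionRing R) m) →
        ∀ (𝔴 : Ideal B) [𝔴.IsPrime], 𝔴.comap (algebraMap R B) = maximalIdeal R →
          P (Localization.AtPrime 𝔴) ∧ Φ (Localization.AtPrime 𝔴) < Φ R)

include hP hΦ hstepK in
/-- Total-ring-of-fractions form of the one-step hypothesis, for `P`, `Φ` defined on local rings
(instance arguments `[IsLocalRing R]`). [cite: StacksProject, Tag 0804] -/
theorem localBlowupChain_hstep_blowupAlgebra_of_fractionRing_local :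
    ∀ (R : Type u) [CommRing R] [IsLocalRing R], P R → ¬ IsRegularLocalRing R →
      ∃ (k : ℕ) (c : Fin k → R), Ideal.span (Set.range c) = maximalIdeal R ∧
        ∀ (j : Fin k) (𝔮 : PrimeSpectrum (blowupAlgebra (Ideal.span (Set.range c)) (c j))),
          𝔮.asIdeal.comap (algebraMap R _) = maximalIdeal R →
            P (Localization.AtPrime 𝔮.asIdeal) ∧ Φ (Localization.AtPrime 𝔮.asIdeal) < Φ R := by
  intro R _ _ hR hreg
  obtain ⟨k, c, hc, hc0, H⟩ := hstepK R hR hreg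
  refine ⟨k, c, hc, fun j 𝔮 h𝔮 => ?_⟩
  obtain ⟨B, 𝔴, hB1, hB2, h𝔴, ⟨ε⟩⟩ := exists_subalgebra_fractionRing_of_blowupAlgebra
    (FractionRing R) (Ideal.span (Set.range c)) (Ideal.mem_span_range_self (f := c) (x := j))
    (hc0 j) 𝔮
  rw [hc] at hB1 hB2
  obtain ⟨hP𝔴, hΦ𝔴⟩ := H j B hB1 hB2 𝔴.asIdeal (h𝔴.trans h𝔮)
  refine ⟨hP _ _ ε.symm hP𝔴, ?_⟩
  rw [← hΦ _ _ ε.symm hP𝔴]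
  exact hΦ𝔴

include hP hΦ hstepK in
/-- **`Kollar2007_thm_1_101_localChain` from a strictly decreasing invariant of local rings,
total-ring-of-fractions form.** [cite: Kollar2007, Thm. 1.101, Def. 1.97, Alg. 1.100 (pp. 57–59)]
[cite: StacksProject, Tag 0804] -/
theorem kollar2007_thm_1_101_localChain_of_invariant_local_fractionRing
    (hA : ∀ (A : Type u) [CommRing A] [IsLocalRing A] [IsNoetherianRing A],
      ringKrullDim A = 1 → IsReduced (AdicCompletion (maximalIdeal A) A) → P A) :
    Kollar2007_thm_1_101_localChain.{u} :=
  kollar2007_thm_1_101_localChain_of_invariant_local_blowupAlgebra P Φ hP hΦ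
    (localBlowupChain_hstep_blowupAlgebra_of_fractionRing_local P Φ hP hΦ hstepK) hA

end FractionRingModelLocal

end Literature.AlgebraicGeometry.Resolution

end
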